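import Literature.Computability.AlgebraicComplexity.Shafiei15CactusRankBound
import Literature.Computability.AlgebraicComplexity.Shafiei15WaringRankBound
import HarnessLib

/-!
# Shafiei 2015, Prop. 3.3: the chain `l_diff(F) ≤ cr(F) ≤ sr(F) ≤ r(F)` — its two elementary links

Topic `Literature/Computability/AlgebraicComplexity`; last file of the apolarity series
`Shafiei15ApolarIdealsDetPerm` (§§1–2) → `Shafiei15WaringRankBound` (Prop. 3.4 / Thm. 3.5 for
points) → `Shafiei15CactusRankBound` (Prop. 3.4 / Thm. 3.5 for zero-dimensional schemes) →
`RS11MonomialCactusRank` (monomials). Everything here is PROVED; no definitions, no named facts.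
Barrier-side bookkeeping only: the bounds are identical for `det_n` and `perm_n` and carry no
separation content.

TYPED-vs-PRINTED. Shafiei 2015, Def. 3.2 / Prop. 3.3 (= [IK] Def. 5.1, Thm. 5.3) print four ranks of a
form `F` — the Waring rank `r(F)` (fewest points `Γ = {[ℓ₁],…,[ℓ_s]} ⊂ 𝐏(R₁)` with `I_Γ ⊂ Ann(F)`,
i.e. `F = Σ c_i ℓ_i^d`, Remark 3.1), the smoothable rank `sr(F)`, the cactus rank `cr(F)` (least
degree of a zero-dimensional `Γ` with `I_Γ ⊂ Ann(F)`) and the differential length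
`l_diff(F) = max_i H(S/Ann F)_i` — and the chain `l_diff(F) ≤ cr(F) ≤ sr(F) ≤ r(F)`. The smoothable
rank `sr` and the two middle links `cr ≤ sr ≤ r` (limits of smooth schemes: deformation theory) are
ABSENT from this file. Typed and proved are the two elementary links, in the dictionary of
`Shafiei15CactusRankBound` (a zero-dimensional scheme `Γ` of degree `e` = a homogeneous SATURATED
ideal `I` whose Hilbert function `H(S/I; t) = dim S_t − dim I_t` is eventually the constant `e`):

* **`l_diff(F) ≤ cr(F)`** ([IK] Thm. 5.3(D)): `hilbertFunction_annihilatorIdeal_le_degree` — for every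
  such `I ⊆ Ann(F)`, `H(S/Ann F; t) ≤ e` for ALL `t`; for `det_n`, `perm_n` this is the flattening
  (catalecticant) bound `binom(n,k)² ≤ e` for every `k` (`choose_sq_le_degree_of_apolar_detPoly/_perPoly`,
  from `hilbertFunction_annihilatorIdeal_detPoly/_perPoly`). Its engine is [IK] Thm. 1.69 / Lemma
  1.67(ii): over an infinite field a saturated ideal `I ≠ S` admits a LINEAR non-zero-divisor
  (`RankChain.exists_linear_nonZeroDivisor`, prime avoidance inside `S₁` against the finitely many
  associated primes, each of which misses a variable by saturation), whence by Philippon's section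
  formula `hilbert_sup_span_add_hilbert_eq` (with `q = 1`) the Hilbert function of `S/I` is
  non-decreasing (`RankChain.hilbertFunction_monotone`) and therefore bounded by its eventual value
  (`RankChain.hilbertFunction_le_of_eventually_eq`).
* **`cr(F) ≤ r(F)`** (Remark 3.1 / [IK] Thm. 5.3(B)): `exists_saturated_apolar_of_waring` — a Waring
  decomposition `F = Σ_{s ∈ S} c_s ℓ_s^d` with all `ℓ_s ≠ 0` yields a homogeneous saturated ideal
  `I = I_Γ ⊆ Ann(F)` (spanned by the forms vanishing at every `ℓ_s`; apolarity by
  `apolarAction_eq_zero_of_eval_eq_zero`) whose Hilbert function is eventually a constant `e ≤ |S|`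
  (`H(S/I_Γ; t)` is the rank of evaluation of `S_t` at `|S|` points, and is monotone). Consequently
  the points case of Ranestad–Schreyer is a corollary of the scheme case
  `sum_hilbertFunction_annihilatorIdeal_le_mul_degree`:
  `sum_hilbertFunction_annihilatorIdeal_le_mul_card_of_span_eq` (`Σ_{t ≤ T} H(S/Ann F; t) ≤ δ·|S|`
  when `Ann(F)` is generated by forms of degree `≤ δ`; the sibling
  `sum_hilbertFunction_annihilatorIdeal_le_mul_card` of `Shafiei15WaringRankBound` assumes instead a
  form `G ∈ Ann(F)_δ` missing the points, which is what generation supplies), and the catalecticant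
  bound for the Waring rank `H(S/Ann F; t) ≤ |S|` (`hilbertFunction_annihilatorIdeal_le_card_of_waring`).

Comparison (Shafiei, Rem. 3.15(a); not typed as an inequality): for `det_n`/`perm_n` the catalecticant
bound gives `cr ≥ binom(n,⌊n/2⌋)² ~ 2·4ⁿ/(πn)`, the Ranestad–Schreyer bound of `Shafiei15CactusRankBound`
`cr ≥ ½·binom(2n,n) ~ 4ⁿ/(2√(πn))`, larger for large `n`. The field is assumed infinite wherever a
non-zero-divisor is chosen. "Saturated" cannot be dropped from link (1): for `F = x₀x₁` and the
non-saturated `I = (y₁², y₀²y₁) ⊂ Ann(F) = (y₀², y₁²)`, `H(S/I; 2) = 2 > 1 = H(S/I; t)` for `t ≥ 3`.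

## References

* S. M. Shafiei, *Apolarity for determinants and permanents of generic matrices*, J. Commut.
  Algebra 7 (2015), Def. 3.2, Rem. 3.1, Prop. 3.3 (p. 7 of arXiv:1212.0515). [`Shafiei2015`]
* A. Iarrobino, V. Kanev, *Power sums, Gorenstein algebras, and determinantal loci*, LNM 1721
  (1999), Lemma 1.67(ii), Theorem 1.69, Definition 5.1, Theorem 5.3 (B), (D). [`IarrobinoKanev1999`]
* K. Ranestad, F.-O. Schreyer, *On the rank of a symmetric form*, J. Algebra 346 (2011),
  Proposition 1. [`RanestadSchreyer2011`]
-/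

noncomputable section

open MvPolynomial Module Finset

attribute [local instance] MvPolynomial.gradedAlgebra

namespace Literature.Computability.AlgebraicComplexity

open Literature.RingTheory.MvPolynomial (idealDegree mem_idealDegree finrank_idealDegree_le
  finite_homogeneousSubmodule hilbert_antitone hilbert_sup_span_add_hilbert_eq
  exists_mem_forall_notMem_of_forall_not_le)

namespace RankChain

variable {K : Type*} [Field K] {σ : Type*}

/-! ### A. The Hilbert function of a zero-dimensional scheme is non-decreasing and bounded by its
degree -/

section Monotone

variable [Fintype σ]

omit [Fintype σ] in
/-- Colon bookkeeping in `S ⧸ I`: `r • (f mod I) = 0 ↔ r f ∈ I`. [folklore] -/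
private theorem mem_colon_bot_mk_iff {I : Ideal (MvPolynomial σ K)} {r f : MvPolynomial σ K} :
    r ∈ (⊥ : Submodule (MvPolynomial σ K) (MvPolynomial σ K ⧸ I)).colon {Ideal.Quotient.mk I f} ↔
      r * f ∈ I := by
  rw [Submodule.mem_colon_singleton, Submodule.mem_bot]
  exact Ideal.Quotient.eq_zero_iff_mem

/-- Saturation keeps the irrelevant ideal away from the associated primes: every associated prime
of `S ⧸ I` misses some variable. [folklore] -/
private theorem exists_X_notMem_of_isAssociatedPrime {I : Ideal (MvPolynomial σ K)}
    (hsat : ∀ f, (∀ i, X i * f ∈ I) → f ∈ I) {P : Ideal (MvPolynomial σ K)}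
    (hP : IsAssociatedPrime P (MvPolynomial σ K ⧸ I)) : ∃ i, (X i : MvPolynomial σ K) ∉ P := by
  rw [isAssociatedPrime_iff] at hP
  obtain ⟨hPprime, x, rfl⟩ := hP
  by_contra h
  push Not at h
  obtain ⟨y, rfl⟩ := Ideal.Quotient.mk_surjective x
  have hy : y ∈ I := hsat y fun i => mem_colon_bot_mk_iff.1 (h i)
  refine hPprime.ne_top (eq_top_iff.2 fun r _ => ?_)
  rw [Submodule.mem_colon_singleton, Submodule.mem_bot, Ideal.Quotient.eq_zero_iff_mem.2 hy, smul_zero]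

/-- **A linear non-zero-divisor** modulo a saturated ideal `I ≠ S`, over an infinite field (a
hyperplane missing every point of the zero-dimensional scheme, and every embedded prime — there is
none): avoidance of the finitely many associated primes inside `S₁` ("every general enough element
`x ∈ (R/I)₁` is a nonzerodivisor"). [cite: IarrobinoKanev1999, Lemma 1.67(ii)] -/
theorem exists_linear_nonZeroDivisor [Infinite K] {I : Ideal (MvPolynomial σ K)}
    (hsat : ∀ f, (∀ i, X i * f ∈ I) → f ∈ I) (hI : I ≠ ⊤) :
    ∃ ℓ : MvPolynomial σ K, ℓ.IsHomogeneous 1 ∧ ℓ ≠ 0 ∧ ∀ f, ℓ * f ∈ I → f ∈ I := by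
  classical
  have hfin := associatedPrimes.finite (A := MvPolynomial σ K) (M := MvPolynomial σ K ⧸ I)
  obtain ⟨g, hgV, hgT⟩ := exists_mem_forall_notMem_of_forall_not_le
    (homogeneousSubmodule σ K 1) (hfin.toFinset.image fun P => P.restrictScalars K)
    (by
      intro W hW hle
      obtain ⟨P, hP, rfl⟩ := Finset.mem_image.1 hW
      obtain ⟨i, hi⟩ := exists_X_notMem_of_isAssociatedPrime hsat (hfin.mem_toFinset.1 hP)
      exact hi (hle ((mem_homogeneousSubmodule 1 _).2 (isHomogeneous_X K i))))
  have hgP : ∀ P ∈ associatedPrimes (MvPolynomial σ K) (MvPolynomial σ K ⧸ I), g ∉ P := fun P hP =>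
    hgT _ (Finset.mem_image_of_mem _ (hfin.mem_toFinset.2 hP))
  refine ⟨g, (mem_homogeneousSubmodule 1 g).1 hgV, ?_, ?_⟩
  · haveI : Nontrivial (MvPolynomial σ K ⧸ I) := Ideal.Quotient.nontrivial_iff.2 hI
    obtain ⟨P, hP⟩ := associatedPrimes.nonempty (MvPolynomial σ K) (MvPolynomial σ K ⧸ I)
    intro hg0
    exact hgP P hP (by rw [hg0]; exact zero_mem _)
  · intro f hgf
    by_contra hf
    have hx : Ideal.Quotient.mk I f ≠ 0 := mt Ideal.Quotient.eq_zero_iff_mem.1 hf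
    obtain ⟨P, hP, hle⟩ := exists_le_isAssociatedPrime_of_isNoetherianRing (MvPolynomial σ K) _ hx
    exact hgP P hP (hle (mem_colon_bot_mk_iff.2 hgf))

/-- **The Hilbert function of a saturated homogeneous ideal is non-decreasing** (`S/I` has a
linear non-zero-divisor `ℓ`, and `H(S/I; t+1) − H(S/I; t) = H(S/(I+(ℓ)); t+1) ≥ 0`, Philippon's
section formula `hilbert_sup_span_add_hilbert_eq`). Infinite field.
[cite: IarrobinoKanev1999, Theorem 1.69] -/
theorem hilbertFunction_le_succ [Infinite K] {I : Ideal (MvPolynomial σ K)}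
    (hIhom : I.IsHomogeneous (homogeneousSubmodule σ K)) (hsat : ∀ f, (∀ i, X i * f ∈ I) → f ∈ I)
    (t : ℕ) :
    finrank K (homogeneousSubmodule σ K t) - finrank K (idealDegree I t) ≤
      finrank K (homogeneousSubmodule σ K (t + 1)) - finrank K (idealDegree I (t + 1)) := by
  by_cases hI : I = ⊤
  · subst hI
    rw [Literature.RingTheory.MvPolynomial.finrank_homogeneousSubmodule_sub_finrank_idealDegree_top]
    exact Nat.zero_le _
  obtain ⟨ℓ, hℓ1, hℓ0, hnzd⟩ := exists_linear_nonZeroDivisor hsat hI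
  have h := hilbert_sup_span_add_hilbert_eq hIhom hℓ0 hℓ1 hnzd t
  omega

/-- Hence the Hilbert function of a saturated homogeneous ideal is monotone ("`H(R/I)_i` is
nondecreasing in `i`"). Infinite field. [cite: IarrobinoKanev1999, Theorem 1.69] -/
theorem hilbertFunction_monotone [Infinite K] {I : Ideal (MvPolynomial σ K)}
    (hIhom : I.IsHomogeneous (homogeneousSubmodule σ K)) (hsat : ∀ f, (∀ i, X i * f ∈ I) → f ∈ I) :
    Monotone fun t => finrank K (homogeneousSubmodule σ K t) - finrank K (idealDegree I t) :=
  monotone_nat_of_le_succ fun t => hilbertFunction_le_succ hIhom hsat t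

/-- **The Hilbert function of a zero-dimensional scheme is bounded by its degree**: if `I` is
homogeneous and saturated with `H(S/I; t) = e` for `t ≥ t₀`, then `H(S/I; t) ≤ e` for ALL `t`.
Infinite field ("… and stabilizes at the value `s = deg Z`", with `s = max_i H(R/I)_i`).
[cite: IarrobinoKanev1999, Theorem 1.69] -/
theorem hilbertFunction_le_of_eventually_eq [Infinite K] {I : Ideal (MvPolynomial σ K)}
    (hIhom : I.IsHomogeneous (homogeneousSubmodule σ K)) (hsat : ∀ f, (∀ i, X i * f ∈ I) → f ∈ I)
    {e t₀ : ℕ} (he : ∀ t, t₀ ≤ t →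
      finrank K (homogeneousSubmodule σ K t) - finrank K (idealDegree I t) = e) (t : ℕ) :
    finrank K (homogeneousSubmodule σ K t) - finrank K (idealDegree I t) ≤ e := by
  rw [← he (max t t₀) (le_max_right _ _)]
  exact hilbertFunction_monotone hIhom hsat (le_max_left t t₀)

end Monotone

/-! ### An order lemma: bounded monotone sequences of naturals are eventually constant -/

/-- A monotone sequence of naturals bounded by `B` is eventually constant, with value `≤ B`.
[folklore] -/
private theorem exists_eventually_eq_of_monotone_of_le {H : ℕ → ℕ} (hmono : Monotone H) {B : ℕ}
    (hB : ∀ t, H t ≤ B) : ∃ e, e ≤ B ∧ ∃ t₀, ∀ t, t₀ ≤ t → H t = e := by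
  have hbdd : BddAbove (Set.range H) := ⟨B, by rintro _ ⟨t, rfl⟩; exact hB t⟩
  obtain ⟨t₀, ht₀⟩ := Nat.sSup_mem (Set.range_nonempty H) hbdd
  refine ⟨H t₀, hB t₀, t₀, fun t ht => le_antisymm ?_ (hmono ht)⟩
  rw [ht₀]
  exact le_csSup hbdd ⟨t, rfl⟩

/-! ### Evaluation at finitely many points: rank–nullity bookkeeping -/

section Points

variable [Fintype σ] {S : Type*} [Fintype S]

omit [Fintype S] in
/-- Rank–nullity for the evaluation map at the points on `S_t`:
`dim S_t = dim (S_t ∩ ker ev) + dim ev(S_t)`. [folklore] -/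
private theorem finrank_homogeneousSubmodule_eq_ker_add_map
    (ev : MvPolynomial σ K →ₗ[K] (S → K)) (t : ℕ) :
    finrank K (homogeneousSubmodule σ K t) =
      finrank K (↥(homogeneousSubmodule σ K t ⊓ LinearMap.ker ev)) +
        finrank K ((homogeneousSubmodule σ K t).map ev) := by
  haveI := finite_homogeneousSubmodule (K := K) (σ := σ) t
  have h := LinearMap.finrank_range_add_finrank_ker (ev.domRestrict (homogeneousSubmodule σ K t))
  rw [LinearMap.range_domRestrict, LinearMap.ker_domRestrict] at h
  rw [← h, add_comm, ← Submodule.finrank_map_subtype_eq, Submodule.map_comap_subtype, inf_comm]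

omit [Fintype σ] in
/-- The image of `S_t` under evaluation at `|S|` points has dimension `≤ |S|`. [folklore] -/
private theorem finrank_map_le_card (ev : MvPolynomial σ K →ₗ[K] (S → K)) (t : ℕ) :
    finrank K ((homogeneousSubmodule σ K t).map ev) ≤ Fintype.card S :=
  ((homogeneousSubmodule σ K t).map ev).finrank_le.trans (Module.finrank_pi K).le

/-- A Waring sum `Σ_s c_s ℓ_s^d` is a form of degree `d`. [folklore] -/
private theorem isHomogeneous_waring (ℓ : S → σ → K) (c : S → K) (d : ℕ) :
    (∑ s, C (c s) * (∑ j, C (ℓ s j) * X j) ^ d : MvPolynomial σ K).IsHomogeneous d := by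
  refine IsHomogeneous.sum _ _ _ fun s _ => ?_
  have h1 : (∑ j, C (ℓ s j) * X j : MvPolynomial σ K).IsHomogeneous 1 :=
    IsHomogeneous.sum _ _ _ fun j _ => isHomogeneous_C_mul_X (ℓ s j) j
  simpa using (h1.pow d).C_mul (c s)

end Points

end RankChain

/-! ### B. Link (1): `l_diff(F) ≤ cr(F)` — the catalecticant bound bounds the cactus rank -/

section LinkOne

variable {K : Type*} [Field K] {σ : Type*} [Fintype σ]

/-- **Shafiei 2015, Prop. 3.3, first link `l_diff(F) ≤ cr(F)`** ([IK] Thm. 5.3(D): "`lsch(f) ≥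
ldiff_k(f)`", proof: "`H(R/Ann(f))_i ≤ H(R/I_Z)_i ≤ s`"). Typed: for every homogeneous SATURATED
ideal `I ⊆ Ann(F)` whose Hilbert function is eventually `e` (the ideal `I_Γ` of a zero-dimensional
scheme `Γ` of degree `e` apolar to `F`), EVERY value of the Hilbert function of `S/Ann(F)` is at
most `e`: `dim S_t − dim Ann(F)_t ≤ e` for all `t`. Infinite field.
[cite: Shafiei2015, Proposition 3.3] [cite: IarrobinoKanev1999, Theorem 5.3(D)] -/
theorem hilbertFunction_annihilatorIdeal_le_degree [Infinite K] {F : MvPolynomial σ K}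
    {I : Ideal (MvPolynomial σ K)} (hIhom : I.IsHomogeneous (homogeneousSubmodule σ K))
    (hsat : ∀ f, (∀ i, X i * f ∈ I) → f ∈ I) (hIF : I ≤ annihilatorIdeal F) {e t₀ : ℕ}
    (he : ∀ t, t₀ ≤ t →
      finrank K (homogeneousSubmodule σ K t) - finrank K (idealDegree I t) = e) (t : ℕ) :
    finrank K (homogeneousSubmodule σ K t) - finrank K (idealDegree (annihilatorIdeal F) t) ≤ e :=
  (hilbert_antitone hIF t).trans (RankChain.hilbertFunction_le_of_eventually_eq hIhom hsat he t)

/-- **The catalecticant (flattening) bound for the cactus rank of the determinant**: every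
zero-dimensional scheme apolar to `det_n` — every homogeneous saturated `I ⊆ Ann(det_n)` whose
Hilbert function is eventually `e` — has `binom(n,k)² ≤ e` for every `k` (Shafiei 2015, Prop. 3.3
with eq. (2.1) `H(S/Ann(det_n))_k = binom(n,k)²`, `hilbertFunction_annihilatorIdeal_detPoly`).
Infinite field. [cite: Shafiei2015, Proposition 3.3] -/
theorem choose_sq_le_degree_of_apolar_detPoly [Infinite K] (n : ℕ)
    {I : Ideal (MvPolynomial (Fin n × Fin n) K)}
    (hIhom : I.IsHomogeneous (homogeneousSubmodule (Fin n × Fin n) K))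
    (hsat : ∀ f, (∀ i, X i * f ∈ I) → f ∈ I) (hIF : I ≤ annihilatorIdeal (detPoly (Fin n) K))
    {e t₀ : ℕ} (he : ∀ t, t₀ ≤ t →
      finrank K (homogeneousSubmodule (Fin n × Fin n) K t) - finrank K (idealDegree I t) = e)
    (k : ℕ) : (n.choose k) ^ 2 ≤ e := by
  rw [← hilbertFunction_annihilatorIdeal_detPoly K n k]
  exact hilbertFunction_annihilatorIdeal_le_degree hIhom hsat hIF he k

/-- **The catalecticant (flattening) bound for the cactus rank of the permanent**: every
homogeneous saturated `I ⊆ Ann(perm_n)` whose Hilbert function is eventually `e` has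
`binom(n,k)² ≤ e` for every `k` (eq. (2.1) for the permanent,
`hilbertFunction_annihilatorIdeal_perPoly`). Infinite field. [cite: Shafiei2015, Proposition 3.3] -/
theorem choose_sq_le_degree_of_apolar_perPoly [Infinite K] (n : ℕ)
    {I : Ideal (MvPolynomial (Fin n × Fin n) K)}
    (hIhom : I.IsHomogeneous (homogeneousSubmodule (Fin n × Fin n) K))
    (hsat : ∀ f, (∀ i, X i * f ∈ I) → f ∈ I) (hIF : I ≤ annihilatorIdeal (perPoly (Fin n) K))
    {e t₀ : ℕ} (he : ∀ t, t₀ ≤ t →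
      finrank K (homogeneousSubmodule (Fin n × Fin n) K t) - finrank K (idealDegree I t) = e)
    (k : ℕ) : (n.choose k) ^ 2 ≤ e := by
  rw [← hilbertFunction_annihilatorIdeal_perPoly K n k]
  exact hilbertFunction_annihilatorIdeal_le_degree hIhom hsat hIF he k

end LinkOne

/-! ### C. Link (2): `cr(F) ≤ r(F)` — a Waring decomposition is a reduced apolar scheme -/

section LinkTwo

variable {K : Type*} [Field K] {σ : Type*} [Fintype σ] {S : Type*} [Fintype S]

/-- **Shafiei 2015, Prop. 3.3, last link `cr(F) ≤ r(F)`** (Remark 3.1 / [IK] Thm. 5.3(B): the points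
`Γ = {[ℓ₁],…,[ℓ_s]}` of a decomposition `F = c₁ℓ₁^d + ⋯ + c_sℓ_s^d` satisfy `I_Γ ⊂ Ann(F)`).
Typed: a Waring decomposition `F = Σ_{s ∈ S} c_s ℓ_s^d` with all `ℓ_s ≠ 0` produces a homogeneous
SATURATED ideal `I ⊆ Ann(F)` (namely `I_Γ`, spanned by the forms vanishing at every `ℓ_s`) whose
Hilbert function `dim S_t − dim I_t` is eventually a constant `e ≤ |S|` (it is the rank of the
evaluation of `S_t` at the `|S|` points, and is non-decreasing) — i.e. a zero-dimensional apolar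
scheme of degree `≤ |S|`. Infinite field. [cite: Shafiei2015, Proposition 3.3]
[cite: IarrobinoKanev1999, Theorem 5.3(B)] -/
theorem exists_saturated_apolar_of_waring [Infinite K] (ℓ : S → σ → K) (c : S → K) (d : ℕ)
    {F : MvPolynomial σ K} (hF : F = ∑ s, C (c s) * (∑ j, C (ℓ s j) * X j) ^ d)
    (hℓ : ∀ s, ℓ s ≠ 0) :
    ∃ I : Ideal (MvPolynomial σ K), I.IsHomogeneous (homogeneousSubmodule σ K) ∧
      (∀ f, (∀ i, X i * f ∈ I) → f ∈ I) ∧ I ≤ annihilatorIdeal F ∧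
      ∃ e, e ≤ Fintype.card S ∧ ∃ t₀, ∀ t, t₀ ≤ t →
        finrank K (homogeneousSubmodule σ K t) - finrank K (idealDegree I t) = e := by
  classical
  set ev : MvPolynomial σ K →ₗ[K] (S → K) := LinearMap.pi fun s => (MvPolynomial.aeval (ℓ s)).toLinearMap
    with hev
  have hev_apply : ∀ D s, ev D s = eval (ℓ s) D := by
    intro D s
    simp [hev]
  -- `I_Γ`: the span of the forms vanishing at every point `ℓ_s`
  set G : Set (MvPolynomial σ K) := {D | (∃ j, D.IsHomogeneous j) ∧ ∀ s, eval (ℓ s) D = 0}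
    with hG
  have hIhom : (Ideal.span G).IsHomogeneous (homogeneousSubmodule σ K) :=
    Ideal.homogeneous_span _ _ fun D hD => by
      obtain ⟨⟨j, hj⟩, -⟩ := hD
      exact ⟨j, (mem_homogeneousSubmodule j D).2 hj⟩
  -- every element of `I_Γ` vanishes at every point
  have hIev : ∀ f ∈ Ideal.span G, ∀ s, eval (ℓ s) f = 0 := by
    intro f hf s
    have hle : Ideal.span G ≤ RingHom.ker (eval (ℓ s)) :=
      Ideal.span_le.2 fun D hD => (RingHom.mem_ker).2 (hD.2 s)
    exact (RingHom.mem_ker).1 (hle hf)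
  -- conversely, a polynomial all of whose components vanish at every point lies in `I_Γ`
  have hmemI : ∀ f : MvPolynomial σ K,
      (∀ j s, eval (ℓ s) (homogeneousComponent j f) = 0) → f ∈ Ideal.span G := by
    intro f hf
    rw [← sum_homogeneousComponent f]
    exact Ideal.sum_mem _ fun j _ =>
      Ideal.subset_span ⟨⟨j, homogeneousComponent_isHomogeneous j f⟩, hf j⟩
  -- saturation: `ℓ_s ≠ 0` has a coordinate `ℓ_s i ≠ 0`, and `(X_i f)_{j+1} = X_i · f_j`
  have hsat : ∀ f, (∀ i, X i * f ∈ Ideal.span G) → f ∈ Ideal.span G := by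
    intro f hXf
    refine hmemI f fun j s => ?_
    obtain ⟨i, hi⟩ := Function.ne_iff.1 (hℓ s)
    have h1 := hIev _ (homogeneousComponent_mem_of_mem hIhom (hXf i) (j + 1)) s
    rw [Literature.RingTheory.MvPolynomial.homogeneousComponent_mul_add_of_isHomogeneous
      (isHomogeneous_X K i) f j, map_mul, eval_X] at h1
    exact (mul_eq_zero.1 h1).resolve_left hi
  -- apolarity (Remark 3.1): forms vanishing at the points annihilate `F`
  have hIF : Ideal.span G ≤ annihilatorIdeal F := by
    refine Ideal.span_le.2 fun D hD => ?_
    obtain ⟨⟨j, hj⟩, hDℓ⟩ := hD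
    rw [SetLike.mem_coe, mem_annihilatorIdeal_iff, hF]
    exact apolarAction_eq_zero_of_eval_eq_zero ℓ c d hj hDℓ
  -- the graded pieces of `I_Γ` are the kernels of evaluation on `S_t`
  have hdeg : ∀ t, idealDegree (Ideal.span G) t = homogeneousSubmodule σ K t ⊓ LinearMap.ker ev := by
    intro t
    ext D
    rw [mem_idealDegree, Submodule.mem_inf, mem_homogeneousSubmodule, LinearMap.mem_ker]
    constructor
    · rintro ⟨hDI, hDt⟩
      refine ⟨hDt, funext fun s => ?_⟩
      rw [hev_apply, Pi.zero_apply]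
      exact hIev D hDI s
    · rintro ⟨hDt, hD0⟩
      refine ⟨Ideal.subset_span ⟨⟨t, hDt⟩, fun s => ?_⟩, hDt⟩
      have h := congr_fun hD0 s
      rwa [hev_apply, Pi.zero_apply] at h
  -- hence `H(S/I_Γ; t) = rank of evaluation ≤ |S|`, and `H` is monotone: eventually constant
  have hbd : ∀ t, finrank K (homogeneousSubmodule σ K t) -
      finrank K (idealDegree (Ideal.span G) t) ≤ Fintype.card S := by
    intro t
    rw [hdeg t, RankChain.finrank_homogeneousSubmodule_eq_ker_add_map ev t, Nat.add_sub_cancel_left]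
    exact RankChain.finrank_map_le_card ev t
  obtain ⟨e, he, t₀, het⟩ := RankChain.exists_eventually_eq_of_monotone_of_le
    (RankChain.hilbertFunction_monotone hIhom hsat) hbd
  exact ⟨Ideal.span G, hIhom, hsat, hIF, e, he, t₀, het⟩

/-- **`l_diff(F) ≤ r(F)` (Sylvester's catalecticant bound for the Waring rank)**: for a Waring
decomposition `F = Σ_{s ∈ S} c_s ℓ_s^d` with all `ℓ_s ≠ 0`, every value of the Hilbert function of
the apolar algebra satisfies `dim S_t − dim Ann(F)_t ≤ |S|` (links (1) and (2) composed; [IK] p. 143: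
"`(H_f)_i = rk Cat_f(i, j−i) ≤ s`"). Infinite field. [cite: Shafiei2015, Proposition 3.3] -/
theorem hilbertFunction_annihilatorIdeal_le_card_of_waring [Infinite K] (ℓ : S → σ → K)
    (c : S → K) (d : ℕ) {F : MvPolynomial σ K}
    (hF : F = ∑ s, C (c s) * (∑ j, C (ℓ s j) * X j) ^ d) (hℓ : ∀ s, ℓ s ≠ 0) (t : ℕ) :
    finrank K (homogeneousSubmodule σ K t) - finrank K (idealDegree (annihilatorIdeal F) t) ≤
      Fintype.card S := by
  obtain ⟨I, hIhom, hsat, hIF, e, he, t₀, het⟩ := exists_saturated_apolar_of_waring ℓ c d hF hℓ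
  exact (hilbertFunction_annihilatorIdeal_le_degree hIhom hsat hIF het t).trans he

/-- **Ranestad–Schreyer for points, recovered from the scheme version** (Shafiei 2015, Prop. 3.4
with `Γ` reduced): if `Ann(F)` is generated by forms of degree `≤ δ` and `F = Σ_{s ∈ S} c_s ℓ_s^d`
with all `ℓ_s ≠ 0`, then `Σ_{t ≤ T} (dim S_t − dim Ann(F)_t) ≤ δ · |S|` for every `T` — the
composite of `exists_saturated_apolar_of_waring` (link (2)) with
`sum_hilbertFunction_annihilatorIdeal_le_mul_degree` of `Shafiei15CactusRankBound`; the sibling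
`sum_hilbertFunction_annihilatorIdeal_le_mul_card` of `Shafiei15WaringRankBound` assumes instead a
form `G ∈ Ann(F)_δ` vanishing at no `ℓ_s`. Infinite field. [cite: Shafiei2015, Proposition 3.4]
[cite: RanestadSchreyer2011, Proposition 1] -/
theorem sum_hilbertFunction_annihilatorIdeal_le_mul_card_of_span_eq [Infinite K] (ℓ : S → σ → K)
    (c : S → K) (d : ℕ) {F : MvPolynomial σ K}
    (hF : F = ∑ s, C (c s) * (∑ j, C (ℓ s j) * X j) ^ d) (hℓ : ∀ s, ℓ s ≠ 0) {δ : ℕ}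
    {G : Set (MvPolynomial σ K)} (hG : ∀ g ∈ G, ∃ j ≤ δ, g.IsHomogeneous j)
    (hgen : annihilatorIdeal F = Ideal.span G) (T : ℕ) :
    ∑ t ∈ range (T + 1), (finrank K (homogeneousSubmodule σ K t) -
        finrank K (idealDegree (annihilatorIdeal F) t)) ≤ δ * Fintype.card S := by
  obtain ⟨I, hIhom, hsat, hIF, e, he, t₀, het⟩ := exists_saturated_apolar_of_waring ℓ c d hF hℓ
  have hFd : F.IsHomogeneous d := by
    rw [hF]
    exact RankChain.isHomogeneous_waring ℓ c d
  exact (sum_hilbertFunction_annihilatorIdeal_le_mul_degree hFd hG hgen hIhom hsat hIF het T).trans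
    (Nat.mul_le_mul_left δ he)

end LinkTwo

end Literature.Computability.AlgebraicComplexity

end
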